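import Summits.ResolutionOfSingularities.ResolutionOfSingularities.Theorems.PurelyInseparableDim4ResConeCInfVirtualEntryPrime
import Summits.ResolutionOfSingularities.ResolutionOfSingularities.Theorems.PurelyInseparableDim4ResConeCInfVirtualEntryRotation
import Summits.ResolutionOfSingularities.ResolutionOfSingularities.Theorems.PurelyInseparableDim4SwapTransportWindowCorePrime
import HarnessLib
import HarnessLib.Audit.Tags

/-!
# Purely inseparable four-folds — THE C∞ VIRTUAL ENTRY FOR EVERY PRIME ALONG A RELATION, AND AT A ROTATION STEP
# (ENTRY-4 of the power-cone light-pair line «light pair of TAIL(p, p−1, 3) ∀ p»; the `(5,4)` instance is res-dim4-p-3 g4's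
# `…ResConeCInfVirtualEntryRotation` p702436) (cell `res-dim4-pi`, K2(p) lane, rung 1)

[OURS · counted 0 · cell `res-dim4-pi` · K2(p) lane (holder res-dim4-p-12 g5, line booked g5-2 (6)); seat res-dim4-p-3 g5.]
Nothing here proves K2(p) for any `p`, any TAIL(p, p−1, 3), any TAIL(7, d, e), `NoIsolatedTrap p p`, the
Cossart–Jannsen–Saito theorem or resolution of singularities in dimension ≥ 4 / characteristic `p` — NOT proved.  AI kernel
work, weaker than expert review.  ENTRY bookkeeping: kills nothing by itself.

* §1 **`exists_cInf_virtual_entry_of_rel_prime`** — COMPOSITION.  A state `A₁` related to the real state `A` along a bijection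
  `π₀` by a slot-unit-class frame at precision `M` (`A₁.F = clean (U′^p·aeval θ′ A.F) + E′`, `θ′ (π₀ λ) = x_λ e′_λ`, …, free
  `(u, f)`-block invertible), a FRAMED re-presentation `C₁` of `A₁` (`C₁.F = clean (tsch f Φ A₁.F)`, ENTRY-2's frame) WITH a
  FLAGGED ROW `(eu, ef)`, `eu + ef = d − 2` (`coeff_{r + λ + μ + (eu+1)u + ef·f} C₁.F ≠ 0`) ⟹ for every jet `N` a virtual state
  `B₀` related to `A` along `π₀` at precision `M` carrying the window's frame with the dead row `(eu, ef)` (ENTRY-3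
  `exists_cInf_virtual_entry_of_framed_prime`, then the chain rule at the origin: `det_free_block_comp`,
  `constantCoeff_aeval_of_origin`, cleaning commutes with substitutions) — res-dim4-typ-1 g5's `hE` conjuncts exactly.  The
  SLOT case of the entry is `π₀ = 1`, `θ′ = X`, `U′ = 1`, `E′ = 0`, `A₁ = A`.
* §2 **`exists_cInf_framed_child_of_rotation_prime`** — AT A REAL ROTATION STEP `A = step p univ g b P` (free letter `g`,
  translated slot `κ` dropped, `b κ′ = b g = 0`): res-dim4-typ-1 g5's regime-free transport core
  `SwapTransport.virtual_core_rotate_prime` (with the trivial relation of the parent `P` to itself) gives the VIRTUAL SLOT child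
  `A₁ = step p univ κ b′ P` related to `A` along `π₀ = (κ g)` at any prescribed precision, with order `d + 2`, ledger
  `x_λx_μ ∣ F`, isolation and `e_G = 3` transported; ENTRY-2 `exists_cInf_framed_child_prime` at the virtual slot step
  `P → A₁` then gives the framed child `C₁` (flag-free).  §1 ∘ (flag) ∘ §2 is the rotation entry; the flag is NOT derived here
  (Q-FLAG at `d ≥ 6`, bus 2026-08-29 10:47Z — OPEN; at `p = 5` it is res-dim4-typ-1 g3's `cInf_uFlag_of_child`).
[cite: CossartJannsenSaito2020, Thm. 3.14, Lemma 13.2] [cite: Hauser2010, §§F–G] [cite: Kollar2007, Aside 3.57]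
bears_on: LADDER-RESOLUTION:D157-DOOR2 (res-dim4-pi · K2(p) · power cones · C∞ entry every prime at a rotation).
Supports stmt-ResolutionOfSingularities-16155 (helper).
-/

set_option linter.dupNamespace false -- mandated namespace of this single-conjunct summit

noncomputable section

namespace Summit.ResolutionOfSingularities.ResolutionOfSingularities.Theorems.PIDim4

namespace ResCone

open MvPolynomial Finset FrameChange
open Literature.AlgebraicGeometry.Resolution
open Literature.AlgebraicGeometry.Resolution.CentreBlowup
open Literature.AlgebraicGeometry.Resolution.Hauser2010
open Literature.AlgebraicGeometry.Resolution.HauserPerlega2019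
open PointBlowup (translate)

variable {K : Type} [Field K] [DecidableEq K]

/-! ## §1 Composition of the entry with an incoming relation -/

/-- **THE C∞ VIRTUAL ENTRY ALONG A RELATION, every prime** (module docstring §1). [OURS]
[cite: CossartJannsenSaito2020, Thm. 3.14, Lemma 13.2] -/
theorem exists_cInf_virtual_entry_of_rel_prime (p : ℕ) [hp : Fact p.Prime] [CharP K p] {d : ℕ} (hdp : d + 1 = p)
    (hd2 : 2 ≤ d) {eu ef : ℕ} (hef : eu + ef = d - 2) {la mu u f : Fin 4} (hlm : la ≠ mu) (hlu : la ≠ u) (hlf : la ≠ f) (hmu : mu ≠ u) (hmf : mu ≠ f)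
    (huf : u ≠ f) {π₀ : Equiv.Perm (Fin 4)} {A A₁ C₁ : State K} {θ' e' : Fin 4 → MvPolynomial (Fin 4) K}
    {U' E' : MvPolynomial (Fin 4) K} {M : ℕ}
    (hθ'la : θ' (π₀ la) = X la * e' la) (hθ'mu : θ' (π₀ mu) = X mu * e' mu) (he'la : constantCoeff (e' la) ≠ 0)
    (he'mu : constantCoeff (e' mu) ≠ 0) (hu0' : constantCoeff (θ' (π₀ u)) = 0) (hf0' : constantCoeff (θ' (π₀ f)) = 0)
    (hdet' : coeff (Finsupp.single u 1) (θ' (π₀ u)) * coeff (Finsupp.single f 1) (θ' (π₀ f)) -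
      coeff (Finsupp.single f 1) (θ' (π₀ u)) * coeff (Finsupp.single u 1) (θ' (π₀ f)) ≠ 0)
    (hU' : constantCoeff U' ≠ 0) (hE' : E' ∈ originIdeal K ^ M)
    (hrel' : A₁.F = deletePthPowers p (U' ^ p * aeval θ' A.F) + E')
    {Φ : MvPolynomial (Fin 4) K} (hΦvars : f ∉ Φ.vars) (hΦ0 : constantCoeff Φ = 0)
    (hC₁F : C₁.F = deletePthPowers p (tsch f Φ A₁.F)) (hoC₁ : ordZero C₁.F = ((d + 2 : ℕ) : ℕ∞))
    (hrC₁ : C₁.r = Finsupp.single la 1 + Finsupp.single mu 1) (hdivC₁ : ∀ e ∈ C₁.F.support, C₁.r ≤ e) {a : K}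
    (ha : a ≠ 0) (hresC₁ : resForm C₁ = C a * X f ^ d)
    (hledC₁ : ∀ e ∈ C₁.F.support, e f ≤ d - 1 → 2 ≤ e la ∧ 2 ≤ e mu) (hisoC₁ : IsIsolated p C₁.F)
    (he3C₁ : Module.finrank K (resVertex C₁) = 3)
    (hV : coeff (C₁.r + (Finsupp.single la 1 + Finsupp.single mu 1 + Finsupp.single u (eu + 1) + Finsupp.single f ef))
      C₁.F ≠ 0) (N : ℕ) :
    ∃ B₀ : State K,
      (∃ (θ e : Fin 4 → MvPolynomial (Fin 4) K) (U E : MvPolynomial (Fin 4) K),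
        θ (π₀ la) = X la * e la ∧ θ (π₀ mu) = X mu * e mu ∧ constantCoeff (e la) ≠ 0 ∧ constantCoeff (e mu) ≠ 0 ∧
        constantCoeff (θ (π₀ u)) = 0 ∧ constantCoeff (θ (π₀ f)) = 0 ∧
        coeff (Finsupp.single u 1) (θ (π₀ u)) * coeff (Finsupp.single f 1) (θ (π₀ f)) -
          coeff (Finsupp.single f 1) (θ (π₀ u)) * coeff (Finsupp.single u 1) (θ (π₀ f)) ≠ 0 ∧
        constantCoeff U ≠ 0 ∧ E ∈ originIdeal K ^ M ∧ B₀.F = deletePthPowers p (U ^ p * aeval θ A.F) + E) ∧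
      ordZero B₀.F = ((d + 2 : ℕ) : ℕ∞) ∧ B₀.r = Finsupp.single la 1 + Finsupp.single mu 1 ∧
      (∀ e ∈ B₀.F.support, B₀.r ≤ e) ∧ (∃ a : K, a ≠ 0 ∧ resForm B₀ = C a * X f ^ d) ∧
      (∀ e ∈ B₀.F.support, e f ≤ d - 1 → 2 ≤ e la ∧ 2 ≤ e mu) ∧
      (∀ e ∈ B₀.F.support, e.degree < N → ¬ (e u = eu ∧ e f = ef)) ∧
      coeff (B₀.r + (Finsupp.single la 1 + Finsupp.single mu 1 + Finsupp.single u (eu + 1) + Finsupp.single f ef)) B₀.F ≠ 0 ∧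
      IsIsolated p B₀.F ∧ Module.finrank K (resVertex B₀) = 3 := by
  have hex : ∀ i : Fin 4, i = la ∨ i = mu ∨ i = u ∨ i = f := letters_exhaust hlm hlu hlf hmu hmf huf
  obtain ⟨B, θ₂, h1, h2, h3, h4, h5, h6, h7, h8, h9, h10, h11, h12, h13, h14, h15⟩ :=
    exists_cInf_virtual_entry_of_framed_prime p hdp hd2 hef hlm hlu hlf hmu hmf huf hΦvars hΦ0 hC₁F hoC₁ hrC₁ hdivC₁ ha
      hresC₁ hledC₁ hisoC₁ he3C₁ hV N
  -- composition of the two relations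
  have hθ₂0 : ∀ i, constantCoeff (θ₂ i) = 0 := fun i => by
    rcases hex i with rfl | rfl | rfl | rfl
    · rw [h1]; exact constantCoeff_X (R := K) _
    · rw [h2]; exact constantCoeff_X (R := K) _
    · exact h3
    · exact h4
  have hrelB : B.F = deletePthPowers p ((aeval θ₂ U') ^ p * aeval (fun i => aeval θ₂ (θ' i)) A.F) +
      deletePthPowers p (aeval θ₂ E') := by
    rw [h6, hrel', map_add, deletePthPowers_add, SwapTransport.deletePthPowers_aeval_deletePthPowers p, map_mul, map_pow,
      ApproxCoordChange.aeval_aeval]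
  have hsla : aeval θ₂ (θ' (π₀ la)) = X la * aeval θ₂ (e' la) := by rw [hθ'la, map_mul, aeval_X, h1]
  have hsmu : aeval θ₂ (θ' (π₀ mu)) = X mu * aeval θ₂ (e' mu) := by rw [hθ'mu, map_mul, aeval_X, h2]
  have hela : constantCoeff (aeval θ₂ (e' la)) ≠ 0 := by
    rw [CoordChange.constantCoeff_aeval_of_origin _ hθ₂0]; exact he'la
  have hemu : constantCoeff (aeval θ₂ (e' mu)) ≠ 0 := by
    rw [CoordChange.constantCoeff_aeval_of_origin _ hθ₂0]; exact he'mu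
  have hu0c : constantCoeff (aeval θ₂ (θ' (π₀ u))) = 0 := by
    rw [CoordChange.constantCoeff_aeval_of_origin _ hθ₂0]; exact hu0'
  have hf0c : constantCoeff (aeval θ₂ (θ' (π₀ f))) = 0 := by
    rw [CoordChange.constantCoeff_aeval_of_origin _ hθ₂0]; exact hf0'
  have hdetc : coeff (Finsupp.single u 1) (aeval θ₂ (θ' (π₀ u))) * coeff (Finsupp.single f 1) (aeval θ₂ (θ' (π₀ f))) -
      coeff (Finsupp.single f 1) (aeval θ₂ (θ' (π₀ u))) * coeff (Finsupp.single u 1) (aeval θ₂ (θ' (π₀ f))) ≠ 0 := by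
    rw [det_free_block_comp hlu hlf hmu hmf huf hex hθ₂0 h1 h2]
    exact mul_ne_zero hdet' h5
  have hUc : constantCoeff (aeval θ₂ U') ≠ 0 := by
    rw [CoordChange.constantCoeff_aeval_of_origin _ hθ₂0]; exact hU'
  have hEc : deletePthPowers p (aeval θ₂ E') ∈ originIdeal K ^ M :=
    SwapNorm.deletePthPowers_mem_pow p (SwapNorm.aeval_mem_pow hθ₂0 hE')
  exact ⟨B, ⟨fun i => aeval θ₂ (θ' i), fun i => aeval θ₂ (e' i), aeval θ₂ U', deletePthPowers p (aeval θ₂ E'),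
    hsla, hsmu, hela, hemu, hu0c, hf0c, hdetc, hUc, hEc, hrelB⟩, h7, h8, h9, h10, h11, h12, h13, h14, h15⟩

/-! ## §2 The framed child at a real rotation step -/

/-- **THE C∞ FRAMED CHILD AT A ROTATION STEP, every prime** (module docstring §2). [OURS]
[cite: CossartJannsenSaito2020, Thm. 3.14, Lemma 13.2] [cite: Hauser2010, §§F–G] -/
theorem exists_cInf_framed_child_of_rotation_prime (p : ℕ) [hp : Fact p.Prime] [CharP K p] {d : ℕ} (hdp : d + 1 = p)
    (hd2 : 2 ≤ d) {la mu u f : Fin 4} (hlm : la ≠ mu) (hlu : la ≠ u) (hlf : la ≠ f) (hmu : mu ≠ u) (hmf : mu ≠ f)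
    (huf : u ≠ f) {κ κ' : Fin 4} (hκ : (κ = la ∧ κ' = mu) ∨ (κ = mu ∧ κ' = la))
    {g gt : Fin 4} (hg : (g = u ∧ gt = f) ∨ (g = f ∧ gt = u)) {P A : State K} {b : Fin 4 → K} (hbg : b g = 0)
    (hbκ : b κ ≠ 0) (hbκ' : b κ' = 0) (hA : A = CentreBlowup.step p Finset.univ g b P)
    (hrP : P.r = Finsupp.single la 1 + Finsupp.single mu 1) (hdivP : ∀ e ∈ P.F.support, P.r ≤ e)
    (hoP : ordZero P.F = ((d + 2 : ℕ) : ℕ∞)) (hcleanP : deletePthPowers p P.F = P.F) (hisoA : IsIsolated p A.F) {Nc : ℕ}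
    (hcert : originIdeal K ^ Nc ≤ singLocusIdeal p A.F ⊔ originIdeal K ^ (Nc + 1)) (hoA : ordZero A.F = ((d + 2 : ℕ) : ℕ∞))
    (he3A : Module.finrank K (resVertex A) = 3) (hrA : A.r = Finsupp.single g 1 + Finsupp.single κ' 1)
    (hdivA : ∀ e ∈ A.F.support, A.r ≤ e) {ℓ : Fin 4 → K} {a0 : K}
    (hform' : resForm P = C a0 * (∑ i, C (ℓ i) * X i) ^ d) (hℓf : ℓ f ≠ 0) {U S T : MvPolynomial (Fin 4) K}
    (hU : MvPolynomial.eval (0 : Fin 4 → K) U ≠ 0)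
    (hledger : U * (P.F.divMonomial P.r) = S * (X la * X mu) + T * (∑ i, C (ℓ i) * X i) ^ d) (M : ℕ) :
    ∃ (A₁ S₂ C₁ : State K) (Φ : MvPolynomial (Fin 4) K) (θ' e' : Fin 4 → MvPolynomial (Fin 4) K)
      (U' E' : MvPolynomial (Fin 4) K),
      -- the virtual slot child `A₁` of `P` is related to the real rotation child `A` along `π₀ = (κ g)`
      θ' (Equiv.swap κ g la) = X la * e' la ∧ θ' (Equiv.swap κ g mu) = X mu * e' mu ∧
      constantCoeff (e' la) ≠ 0 ∧ constantCoeff (e' mu) ≠ 0 ∧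
      constantCoeff (θ' (Equiv.swap κ g u)) = 0 ∧ constantCoeff (θ' (Equiv.swap κ g f)) = 0 ∧
      coeff (Finsupp.single u 1) (θ' (Equiv.swap κ g u)) * coeff (Finsupp.single f 1) (θ' (Equiv.swap κ g f)) -
        coeff (Finsupp.single f 1) (θ' (Equiv.swap κ g u)) * coeff (Finsupp.single u 1) (θ' (Equiv.swap κ g f)) ≠ 0 ∧
      constantCoeff U' ≠ 0 ∧ E' ∈ originIdeal K ^ M ∧ A₁.F = deletePthPowers p (U' ^ p * aeval θ' A.F) + E' ∧
      A.r = Finsupp.single (Equiv.swap κ g la) 1 + Finsupp.single (Equiv.swap κ g mu) 1 ∧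
      -- ENTRY-2 at the virtual slot step `P → A₁`
      C₁ = CentreBlowup.step p Finset.univ κ 0 S₂ ∧
      S₂.r = Finsupp.single la 1 + Finsupp.single mu 1 ∧ (∀ e ∈ S₂.F.support, S₂.r ≤ e) ∧
      ordZero S₂.F = ((d + 2 : ℕ) : ℕ∞) ∧ resForm S₂ = C (a0 * ℓ f ^ d) * X f ^ d ∧
      (∀ e ∈ S₂.F.support, e f ≤ d - 1 → 2 ≤ e la ∧ 2 ≤ e mu) ∧
      f ∉ Φ.vars ∧ constantCoeff Φ = 0 ∧ C₁.F = deletePthPowers p (tsch f Φ A₁.F) ∧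
      ordZero C₁.F = ((d + 2 : ℕ) : ℕ∞) ∧ C₁.r = Finsupp.single la 1 + Finsupp.single mu 1 ∧
      (∀ e ∈ C₁.F.support, C₁.r ≤ e) ∧
      a0 * ℓ f ^ d ≠ 0 ∧ resForm C₁ = C (a0 * ℓ f ^ d) * X f ^ d ∧
      (∀ e ∈ C₁.F.support, e f ≤ d - 1 → 2 ≤ e la ∧ 2 ≤ e mu) ∧
      IsIsolated p C₁.F ∧ Module.finrank K (resVertex C₁) = 3 := by
  -- (0) letters
  obtain ⟨hκκ', hκu, hκf, hκ'u, hκ'f⟩ : κ ≠ κ' ∧ κ ≠ u ∧ κ ≠ f ∧ κ' ≠ u ∧ κ' ≠ f := by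
    rcases hκ with ⟨rfl, rfl⟩ | ⟨rfl, rfl⟩
    · exact ⟨hlm, hlu, hlf, hmu, hmf⟩
    · exact ⟨hlm.symm, hmu, hmf, hlu, hlf⟩
  obtain ⟨hκg, hκ'g⟩ : κ ≠ g ∧ κ' ≠ g := by
    rcases hg with ⟨rfl, rfl⟩ | ⟨rfl, rfl⟩
    · exact ⟨hκu, hκ'u⟩
    · exact ⟨hκf, hκ'f⟩
  have hκlm : κ = la ∨ κ = mu := by
    rcases hκ with ⟨h, -⟩ | ⟨h, -⟩
    · exact Or.inl h
    · exact Or.inr h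
  have hpair : Finsupp.single κ 1 + Finsupp.single κ' 1 = (Finsupp.single la 1 + Finsupp.single mu 1 : Fin 4 →₀ ℕ) := by
    rcases hκ with ⟨rfl, rfl⟩ | ⟨rfl, rfl⟩
    · rfl
    · rw [add_comm]
  have hd2p : ((d + 2 : ℕ) : ℕ∞) = ((p + 1 : ℕ) : ℕ∞) := by rw [show d + 2 = p + 1 by omega]
  have hoPp : ordZero P.F = ((p + 1 : ℕ) : ℕ∞) := by rw [hoP, hd2p]
  have hoAp : ordZero A.F = ((p + 1 : ℕ) : ℕ∞) := by rw [hoA, hd2p]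
  have hrPκ : P.r = Finsupp.single κ 1 + Finsupp.single κ' 1 := by rw [hrP, hpair]
  -- (1) the trivial relation of the parent to itself: `θ = X`, `e = 1`, `U = 1`, `E = 0`, `π = 1`
  have hθa : (X : Fin 4 → MvPolynomial (Fin 4) K) ((1 : Equiv.Perm (Fin 4)) κ) =
      X κ * (fun _ => (1 : MvPolynomial (Fin 4) K)) κ := by rw [Equiv.Perm.one_apply, mul_one]
  have hθa' : (X : Fin 4 → MvPolynomial (Fin 4) K) ((1 : Equiv.Perm (Fin 4)) κ') =
      X κ' * (fun _ => (1 : MvPolynomial (Fin 4) K)) κ' := by rw [Equiv.Perm.one_apply, mul_one]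
  have hea : constantCoeff ((fun _ => (1 : MvPolynomial (Fin 4) K)) κ) ≠ 0 := by
    dsimp only; rw [map_one]; exact one_ne_zero
  have hea' : constantCoeff ((fun _ => (1 : MvPolynomial (Fin 4) K)) κ') ≠ 0 := by
    dsimp only; rw [map_one]; exact one_ne_zero
  have hu0 : constantCoeff ((X : Fin 4 → MvPolynomial (Fin 4) K) ((1 : Equiv.Perm (Fin 4)) u)) = 0 := by
    rw [Equiv.Perm.one_apply]; exact constantCoeff_X (R := K) u
  have hf0 : constantCoeff ((X : Fin 4 → MvPolynomial (Fin 4) K) ((1 : Equiv.Perm (Fin 4)) f)) = 0 := by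
    rw [Equiv.Perm.one_apply]; exact constantCoeff_X (R := K) f
  have hU1 : constantCoeff (1 : MvPolynomial (Fin 4) K) ≠ 0 := by rw [map_one]; exact one_ne_zero
  have hE0 : (0 : MvPolynomial (Fin 4) K) ∈ originIdeal K ^ (M + Nc + 2 * p + 2) := Submodule.zero_mem _
  have hrel0 : P.F = deletePthPowers p ((1 : MvPolynomial (Fin 4) K) ^ p *
      aeval (X : Fin 4 → MvPolynomial (Fin 4) K) P.F) + 0 := by
    rw [one_pow, one_mul, MvPolynomial.aeval_X_left, AlgHom.id_apply, hcleanP, add_zero]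
  have hdet1 : coeff (Finsupp.single u 1) ((X : Fin 4 → MvPolynomial (Fin 4) K) ((1 : Equiv.Perm (Fin 4)) u)) *
        coeff (Finsupp.single f 1) ((X : Fin 4 → MvPolynomial (Fin 4) K) ((1 : Equiv.Perm (Fin 4)) f)) -
      coeff (Finsupp.single f 1) ((X : Fin 4 → MvPolynomial (Fin 4) K) ((1 : Equiv.Perm (Fin 4)) u)) *
        coeff (Finsupp.single u 1) ((X : Fin 4 → MvPolynomial (Fin 4) K) ((1 : Equiv.Perm (Fin 4)) f)) ≠ 0 := by
    have h1 : coeff (Finsupp.single f 1) (X u : MvPolynomial (Fin 4) K) = 0 := by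
      rw [coeff_X, if_neg]; exact fun h => huf (Finsupp.single_left_injective one_ne_zero h)
    rw [Equiv.Perm.one_apply, Equiv.Perm.one_apply, coeff_X_same, coeff_X_same, h1, zero_mul, sub_zero, mul_one]
    exact one_ne_zero
  have hbg1 : b ((1 : Equiv.Perm (Fin 4)) g) = 0 := by rw [Equiv.Perm.one_apply]; exact hbg
  have hbκ1 : b ((1 : Equiv.Perm (Fin 4)) κ) ≠ 0 := by rw [Equiv.Perm.one_apply]; exact hbκ
  have hbκ'1 : b ((1 : Equiv.Perm (Fin 4)) κ') = 0 := by rw [Equiv.Perm.one_apply]; exact hbκ'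
  have hA1 : A = CentreBlowup.step p Finset.univ ((1 : Equiv.Perm (Fin 4)) g) b P := by rw [Equiv.Perm.one_apply]; exact hA
  have hrA1 : A.r = Finsupp.single ((1 : Equiv.Perm (Fin 4)) g) 1 + Finsupp.single ((1 : Equiv.Perm (Fin 4)) κ') 1 := by
    rw [Equiv.Perm.one_apply, Equiv.Perm.one_apply]; exact hrA
  -- (2) res-dim4-typ-1 g5's transport core at the rotation step
  obtain ⟨π', b', θ', e', U', E', hπ', -, -, -, -, hb'κ, hb'κ', hθ'κ, hθ'κ', he'κ, he'κ', hu0', hf0', hdet', hU', hE',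
      hrel', hoA₁, hrA₁, hdivA₁, hisoA₁, he3A₁⟩ :=
    SwapTransport.virtual_core_rotate_prime p (π := (1 : Equiv.Perm (Fin 4))) hκκ' hκu hκf hκ'u hκ'f huf hg
      (A := P) (B := P) (θ := (X : Fin 4 → MvPolynomial (Fin 4) K)) (e := fun _ => (1 : MvPolynomial (Fin 4) K))
      (U := 1) (E := 0) (M := M + Nc + 2 * p + 2) hθa hθa' hea hea' hu0 hf0 hdet1 hU1 hE0 hrel0 hoPp hbg1 hbκ1 hbκ'1 hA1
      hisoA hcert hoAp he3A hrA1 hdivA hoPp hrPκ hdivP (by omega)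
  have hπx : ∀ x, π' x = Equiv.swap κ g x := fun x => by rw [hπ']; rfl
  simp only [hπx] at hθ'κ hθ'κ' hdet' hu0' hf0' hrel'
  set A₁ : State K := CentreBlowup.step p Finset.univ κ b' P with hA₁
  have hrA₁' : A₁.r = Finsupp.single la 1 + Finsupp.single mu 1 := by rw [hrA₁, hpair]
  have hoA₁' : ordZero A₁.F = ((d + 2 : ℕ) : ℕ∞) := by rw [hoA₁, hd2p]
  -- (3) ENTRY-2 at the virtual slot step `P → A₁`
  have hb'la : b' la = 0 := by
    rcases hκ with ⟨rfl, rfl⟩ | ⟨rfl, rfl⟩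
    · exact hb'κ
    · exact hb'κ'
  have hb'mu : b' mu = 0 := by
    rcases hκ with ⟨rfl, rfl⟩ | ⟨rfl, rfl⟩
    · exact hb'κ'
    · exact hb'κ
  obtain ⟨S₂, C₁, Φ, hC₁, hrS₂, hdivS₂, hoS₂, hresS₂, hledS₂, hΦvars, hΦ0, hC₁F, hoC₁, hrC₁, hdivC₁, hA0, hresC₁, hledC₁,
      hisoC₁, he3C₁⟩ :=
    exists_cInf_framed_child_prime p hdp hd2 hlm hlu hlf hmu hmf huf hκlm (A' := P) (A := A₁) (β := b') hb'κ hb'la hb'mu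
      hA₁ hrP hrA₁' hdivP hdivA₁ hoP hoA₁' hcleanP hisoA₁ he3A₁ hform' hℓf hU hledger
  -- (4) the slot relations in the letters `λ μ`
  have hπκ : Equiv.swap κ g κ = g := Equiv.swap_apply_left κ g
  have hπκ' : Equiv.swap κ g κ' = κ' := Equiv.swap_apply_of_ne_of_ne (Ne.symm hκκ') hκ'g
  have hsla : θ' (Equiv.swap κ g la) = X la * e' la := by
    rcases hκ with ⟨rfl, rfl⟩ | ⟨rfl, rfl⟩
    · exact hθ'κ
    · exact hθ'κ'
  have hsmu : θ' (Equiv.swap κ g mu) = X mu * e' mu := by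
    rcases hκ with ⟨rfl, rfl⟩ | ⟨rfl, rfl⟩
    · exact hθ'κ'
    · exact hθ'κ
  have hela : constantCoeff (e' la) ≠ 0 := by
    rcases hκ with ⟨rfl, rfl⟩ | ⟨rfl, rfl⟩
    · exact he'κ
    · exact he'κ'
  have hemu : constantCoeff (e' mu) ≠ 0 := by
    rcases hκ with ⟨rfl, rfl⟩ | ⟨rfl, rfl⟩
    · exact he'κ'
    · exact he'κ
  have hrAπ : A.r = Finsupp.single (Equiv.swap κ g la) 1 + Finsupp.single (Equiv.swap κ g mu) 1 := by
    rcases hκ with ⟨rfl, rfl⟩ | ⟨rfl, rfl⟩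
    · rw [hπκ, hπκ']; exact hrA
    · rw [hπκ, hπκ', add_comm]; exact hrA
  exact ⟨A₁, S₂, C₁, Φ, θ', e', U', E', hsla, hsmu, hela, hemu, hu0', hf0', hdet', hU',
    Ideal.pow_le_pow_right (by omega) hE', hrel', hrAπ, hC₁, hrS₂, hdivS₂, hoS₂, hresS₂, hledS₂, hΦvars, hΦ0, hC₁F, hoC₁,
    hrC₁, hdivC₁, hA0, hresC₁, hledC₁, hisoC₁, he3C₁⟩

end ResCone

end Summit.ResolutionOfSingularities.ResolutionOfSingularities.Theorems.PIDim4

end
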